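import Mathlib.Analysis.InnerProductSpace.Projection.Reflection
import Literature.MathematicalPhysics.StatisticalMechanics.BarlowStacking

/-!
# Alternating Barlow windows are hcp windows

Routes `SquareWellLayerCake` / `LaminarSixThreeThree` (sub-problem `Crystallization`), support of item
`stmt-AtomisticToContinuum-14296` (`StackingFaultSparsity`): stub `stub_windowToHcp` of line `Sketch`
(pure geometry of Barlow stackings, no physics).

Let `z = barlowPos a h s k₀ i₀ j₀` and `L = haggLabel s`. If the Hägg word alternates
(`s (m + 1) = - s m`) on all layers `m` with `|m - k₀| ≤ M`, then by `haggLabel_succ` the labels seen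
from layer `k₀` are `L (k₀ + t) - L k₀ = 0, σ, 0, σ, …` (`|t| ≤ M`), i.e. the labels of
`alternatingHagg` (`haggLabel_alternating`) times the sign `σ = s k₀ = ±1`. Hence
`barlowPos a h s (k₀ + t) (i₀ + σ i) (j₀ + σ j) - z = B_σ (barlowPos a h alternatingHagg t i j)`, where
`B₁ = id` and `B₋₁` is the half-turn about the vertical axis (the reflection of `ℝ³` in the line
`ℝ e₃`: a linear isometry with `u, v, w ↦ -u, -v, -w`, `e₃ ↦ e₃`). Every stacking point within
`R + ε < M h` of the base of the window (in either stacking) lies in a layer `|t| ≤ M`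
(`|x₂| ≤ ‖x‖`), so the two matching clauses transfer from `(barlowStacking a h s, z, A)` to
`(hcpStacking a h, 0, A ∘ B_σ)`.
-/

noncomputable section
namespace Summit.AtomisticToContinuum.Crystallization.Theorems.SquareWellLayerCake.StackingFaultSparsity
open Literature.MathematicalPhysics.StatisticalMechanics
/-- Euclidean `3`-space. [folklore] -/
local notation "E3" => EuclideanSpace ℝ (Fin 3)

/-! ## Labels of an alternating stretch of the Hägg word -/

/-- Forward propagation of the alternation: for `n ≤ M`, layer `k₀ + n` has label
`L k₀ + (0 or s k₀)` and letter `± s k₀` according to the parity of `n`. [folklore] -/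
theorem haggLabel_add_of_alternating {s : ℤ → ℤ} {k₀ : ℤ} {M : ℕ}
    (halt : ∀ m : ℤ, |m - k₀| ≤ M → s (m + 1) = -s m) :
    ∀ n : ℕ, n ≤ M →
      haggLabel s (k₀ + n) = haggLabel s k₀ + (if Even n then 0 else s k₀) ∧
        s (k₀ + n) = (if Even n then s k₀ else -s k₀) := by
  intro n
  induction n with
  | zero => intro; simp
  | succ n ih =>
    intro hn
    obtain ⟨hL, hs⟩ := ih (Nat.le_of_succ_le hn)
    have hm : s (k₀ + n + 1) = -s (k₀ + n) :=
      halt (k₀ + n) (by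
        rw [add_sub_cancel_left, Nat.abs_cast]
        exact_mod_cast Nat.le_of_succ_le hn)
    refine ⟨?_, ?_⟩
    · rw [Nat.cast_succ, ← add_assoc, haggLabel_succ, hL, hs]
      by_cases he : Even n
      · have hne : ¬ Even (n + 1) := by simp [Nat.even_add_one, he]
        rw [if_pos he, if_pos he, if_neg hne, add_zero]
      · have hne : Even (n + 1) := by simp [Nat.even_add_one, he]
        rw [if_neg he, if_neg he, if_pos hne, add_zero, add_neg_cancel_right]
    · rw [Nat.cast_succ, ← add_assoc, hm, hs]
      by_cases he : Even n
      · have hne : ¬ Even (n + 1) := by simp [Nat.even_add_one, he]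
        rw [if_pos he, if_neg hne]
      · have hne : Even (n + 1) := by simp [Nat.even_add_one, he]
        rw [if_neg he, if_pos hne, neg_neg]

/-- Backward propagation of the alternation: for `n ≤ M`, layer `k₀ - n` has label
`L k₀ + (0 or s k₀)` and letter `± s k₀` according to the parity of `n`. [folklore] -/
theorem haggLabel_sub_of_alternating {s : ℤ → ℤ} {k₀ : ℤ} {M : ℕ}
    (halt : ∀ m : ℤ, |m - k₀| ≤ M → s (m + 1) = -s m) :
    ∀ n : ℕ, n ≤ M →
      haggLabel s (k₀ - n) = haggLabel s k₀ + (if Even n then 0 else s k₀) ∧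
        s (k₀ - n) = (if Even n then s k₀ else -s k₀) := by
  intro n
  induction n with
  | zero => intro; simp
  | succ n ih =>
    intro hn
    obtain ⟨hL, hs⟩ := ih (Nat.le_of_succ_le hn)
    -- the alternation at `m = k₀ - (n + 1)`
    have hm : s (k₀ - n) = -s (k₀ - (n + 1 : ℕ)) := by
      have h1 := halt (k₀ - (n + 1 : ℕ)) (by
        rw [sub_sub_cancel_left, abs_neg, Nat.abs_cast]
        exact_mod_cast hn)
      rw [← h1]
      congr 1
      push_cast
      ring
    have hs' : s (k₀ - (n + 1 : ℕ)) = (if Even (n + 1) then s k₀ else -s k₀) := by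
      have h2 : s (k₀ - (n + 1 : ℕ)) = -s (k₀ - n) := by rw [hm, neg_neg]
      rw [h2, hs]
      by_cases he : Even n
      · have hne : ¬ Even (n + 1) := by simp [Nat.even_add_one, he]
        rw [if_pos he, if_neg hne]
      · have hne : Even (n + 1) := by simp [Nat.even_add_one, he]
        rw [if_neg he, if_pos hne, neg_neg]
    refine ⟨?_, hs'⟩
    have hrec : haggLabel s (k₀ - n) =
        haggLabel s (k₀ - (n + 1 : ℕ)) + s (k₀ - (n + 1 : ℕ)) := by
      rw [← haggLabel_succ]
      congr 1
      push_cast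
      ring
    have h3 : haggLabel s (k₀ - (n + 1 : ℕ)) = haggLabel s (k₀ - n) - s (k₀ - (n + 1 : ℕ)) := by
      rw [hrec, add_sub_cancel_right]
    rw [h3, hL, hs']
    by_cases he : Even n
    · have hne : ¬ Even (n + 1) := by simp [Nat.even_add_one, he]
      rw [if_pos he, if_neg hne, if_neg hne, add_zero, sub_neg_eq_add]
    · have hne : Even (n + 1) := by simp [Nat.even_add_one, he]
      rw [if_neg he, if_pos hne, if_pos hne, add_zero, add_sub_cancel_right]

/-- **The labels of the layers within `M` of `k₀`** of an alternating stretch: those of the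
alternating sequence (`0` on even, `1` on odd offsets) times the letter `s k₀`. [folklore] -/
theorem haggLabel_of_alternating {s : ℤ → ℤ} {k₀ : ℤ} {M : ℕ}
    (halt : ∀ m : ℤ, |m - k₀| ≤ M → s (m + 1) = -s m) {k : ℤ} (hk : |k - k₀| ≤ M) :
    haggLabel s k = haggLabel s k₀ + (if Even (k - k₀) then 0 else s k₀) := by
  obtain ⟨n, hn | hn⟩ := Int.eq_nat_or_neg (k - k₀)
  · have hnM : n ≤ M := by
      rw [hn, Nat.abs_cast] at hk
      exact_mod_cast hk
    have hk' : k = k₀ + n := by omega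
    subst hk'
    rw [(haggLabel_add_of_alternating halt n hnM).1, add_sub_cancel_left]
    by_cases he : Even n <;> simp [he, Int.even_coe_nat]
  · have hnM : n ≤ M := by
      rw [hn, abs_neg, Nat.abs_cast] at hk
      exact_mod_cast hk
    have hk' : k = k₀ - n := by omega
    subst hk'
    rw [(haggLabel_sub_of_alternating halt n hnM).1, sub_sub_cancel_left]
    by_cases he : Even n <;> simp [he, Int.even_coe_nat, even_neg]

/-! ## The half-turn about the vertical axis -/

/-- **A linear isometry acting as the sign `σ = ±1` on the horizontal vectors `u, v, w` and fixing
`h e₃`**: the identity for `σ = 1`, the half-turn about the vertical axis (reflection of `ℝ³` in the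
line `ℝ e₃`) for `σ = -1`. [folklore] -/
theorem exists_linearIsometry_sign (a h : ℝ) {σ : ℤ} (hσ : σ = 1 ∨ σ = -1) :
    ∃ B : E3 →ₗᵢ[ℝ] E3,
      B (triangularVec₁ a) = (σ : ℝ) • triangularVec₁ a ∧
        B (triangularVec₂ a) = (σ : ℝ) • triangularVec₂ a ∧
          B (barlowOffset a) = (σ : ℝ) • barlowOffset a ∧ B (layerNormal h) = layerNormal h := by
  rcases hσ with rfl | rfl
  · exact ⟨LinearIsometry.id, by simp, by simp, by simp, by simp⟩
  · have horth : ∀ x : E3, x 2 = 0 →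
        (ℝ ∙ EuclideanSpace.single (2 : Fin 3) (1 : ℝ)).reflection x = -x := fun x hx =>
      Submodule.reflection_mem_subspace_orthogonalComplement_eq_neg
        ((Submodule.mem_orthogonal_singleton_iff_inner_right).2
          (by rw [EuclideanSpace.inner_single_left, hx, mul_zero]))
    refine ⟨(ℝ ∙ EuclideanSpace.single (2 : Fin 3) (1 : ℝ)).reflection.toLinearIsometry,
      ?_, ?_, ?_, ?_⟩
    · rw [LinearIsometryEquiv.coe_toLinearIsometry, Int.cast_neg, Int.cast_one, neg_smul, one_smul]
      exact horth _ (by simp [triangularVec₁])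
    · rw [LinearIsometryEquiv.coe_toLinearIsometry, Int.cast_neg, Int.cast_one, neg_smul, one_smul]
      exact horth _ (by simp [triangularVec₂])
    · rw [LinearIsometryEquiv.coe_toLinearIsometry, Int.cast_neg, Int.cast_one, neg_smul, one_smul]
      exact horth _ (by simp [barlowOffset])
    · rw [LinearIsometryEquiv.coe_toLinearIsometry]
      exact Submodule.reflection_mem_subspace_eq_self
        (Submodule.mem_span_singleton.2 ⟨h, by ext l; fin_cases l <;> simp [layerNormal]⟩)

/-! ## The correspondence between the two stackings near the base layer -/

/-- **Seen from `z = barlowPos a h s k₀ i₀ j₀`, the layers `|k - k₀| ≤ M` of `barlowStacking a h s`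
are the image under `B_σ` (`σ = s k₀`) of the layers `k - k₀` of `hcpStacking a h`.** [folklore] -/
theorem barlowPos_sub_eq_of_alternating {a h : ℝ} {s : ℤ → ℤ} {k₀ : ℤ} {M : ℕ} {σ : ℤ}
    (hσ : σ = 1 ∨ σ = -1) (hsk : s k₀ = σ) (halt : ∀ m : ℤ, |m - k₀| ≤ M → s (m + 1) = -s m)
    {B : E3 →ₗᵢ[ℝ] E3} (hBu : B (triangularVec₁ a) = (σ : ℝ) • triangularVec₁ a)
    (hBv : B (triangularVec₂ a) = (σ : ℝ) • triangularVec₂ a)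
    (hBw : B (barlowOffset a) = (σ : ℝ) • barlowOffset a) (hBe : B (layerNormal h) = layerNormal h)
    (i₀ j₀ : ℤ) {k : ℤ} (hk : |k - k₀| ≤ M) (i j : ℤ) :
    barlowPos a h s k i j - barlowPos a h s k₀ i₀ j₀ =
      B (barlowPos a h alternatingHagg (k - k₀) (σ * (i - i₀)) (σ * (j - j₀))) := by
  have hL := haggLabel_of_alternating halt hk
  rw [hsk] at hL
  simp only [barlowPos, map_add, LinearIsometry.map_smul, hBu, hBv, hBw, hBe, haggLabel_alternating,
    hL]
  rcases hσ with rfl | rfl <;> by_cases he : Even (k - k₀) <;> simp only [if_pos, if_neg, he,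
    not_false_eq_true] <;> push_cast <;> module

/-- The forward form of `barlowPos_sub_eq_of_alternating`: the hcp point `(t, i, j)`, `|t| ≤ M`,
corresponds to the Barlow point `(k₀ + t, i₀ + σ i, j₀ + σ j)`. [folklore] -/
theorem barlowPos_add_sub_eq_of_alternating {a h : ℝ} {s : ℤ → ℤ} {k₀ : ℤ} {M : ℕ} {σ : ℤ}
    (hσ : σ = 1 ∨ σ = -1) (hsk : s k₀ = σ) (halt : ∀ m : ℤ, |m - k₀| ≤ M → s (m + 1) = -s m)
    {B : E3 →ₗᵢ[ℝ] E3} (hBu : B (triangularVec₁ a) = (σ : ℝ) • triangularVec₁ a)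
    (hBv : B (triangularVec₂ a) = (σ : ℝ) • triangularVec₂ a)
    (hBw : B (barlowOffset a) = (σ : ℝ) • barlowOffset a) (hBe : B (layerNormal h) = layerNormal h)
    (i₀ j₀ : ℤ) {t : ℤ} (ht : |t| ≤ M) (i j : ℤ) :
    barlowPos a h s (k₀ + t) (i₀ + σ * i) (j₀ + σ * j) - barlowPos a h s k₀ i₀ j₀ =
      B (barlowPos a h alternatingHagg t i j) := by
  have hσ2 : σ * σ = 1 := by rcases hσ with rfl | rfl <;> norm_num
  have key := barlowPos_sub_eq_of_alternating hσ hsk halt hBu hBv hBw hBe i₀ j₀ (k := k₀ + t)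
    (by simpa using ht) (i₀ + σ * i) (j₀ + σ * j)
  rwa [show k₀ + t - k₀ = t by ring, show σ * (i₀ + σ * i - i₀) = i by
    rw [add_sub_cancel_left, ← mul_assoc, hσ2, one_mul], show σ * (j₀ + σ * j - j₀) = j by
    rw [add_sub_cancel_left, ← mul_assoc, hσ2, one_mul]] at key

/-! ## Vertical localisation -/

/-- A vector of height `t h` and norm `< M h` has `|t| ≤ M` (indeed `< M`). [folklore] -/
theorem abs_le_of_norm_lt {h : ℝ} (hh : 0 < h) {M : ℕ} {t : ℤ} {x : E3} (hx : x 2 = t * h)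
    (hlt : ‖x‖ < M * h) : |t| ≤ M := by
  have h1 : |(t : ℝ)| * h < M * h :=
    calc |(t : ℝ)| * h = ‖x 2‖ := by rw [hx, Real.norm_eq_abs, abs_mul, abs_of_pos hh]
      _ ≤ ‖x‖ := PiLp.norm_apply_le x 2
      _ < M * h := hlt
  have h2 : |(t : ℝ)| < M := lt_of_mul_lt_mul_right h1 hh.le
  have h3 : ((|t| : ℤ) : ℝ) < ((M : ℤ) : ℝ) := by rw [Int.cast_abs, Int.cast_natCast]; exact h2
  exact (Int.cast_lt.1 h3).le

/-! ## The stub -/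

/-- **Stub `stub_windowToHcp`** of line `Sketch` of crux `StackingFaultSparsity` (pure geometry).
If the window of `i` is two-way `(R, ε)`-matched to `barlowStacking a h s` based at the stacking point
`barlowPos a h s k₀ i₀ j₀` after the linear isometry `A`, and the Hägg word `s` alternates on every
layer within `M` of `k₀`, where `R + ε < M h`, then the same window is two-way `(R, ε)`-matched to
`hcpStacking a h` based at `0 = barlowPos a h alternatingHagg 0 0 0`, after `A ∘ B_σ` with `B_σ` the
identity (`s k₀ = 1`) or the half-turn about the vertical axis (`s k₀ = -1`). [folklore] -/
theorem stub_windowToHcp :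
    ∀ {N : ℕ} (y : Fin N → E3) (i : Fin N) (a h R ε : ℝ) (s : ℤ → ℤ) (k₀ i₀ j₀ : ℤ) (M : ℕ)
      (A : E3 →ₗᵢ[ℝ] E3), 0 < a → 0 < h → 0 ≤ ε → R + ε < M * h → IsHaggSeq s →
      (∀ m : ℤ, |m - k₀| ≤ M → s (m + 1) = -s m) →
      ((∀ p ∈ barlowStacking a h s, dist p (barlowPos a h s k₀ i₀ j₀) ≤ R →
          ∃ j : Fin N, dist (y j) (y i + A (p - barlowPos a h s k₀ i₀ j₀)) ≤ ε) ∧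
        (∀ j : Fin N, dist (y j) (y i) ≤ R →
          ∃ p ∈ barlowStacking a h s, dist (y j) (y i + A (p - barlowPos a h s k₀ i₀ j₀)) ≤ ε)) →
      ∃ z' ∈ hcpStacking a h, ∃ A' : E3 →ₗᵢ[ℝ] E3,
        (∀ p ∈ hcpStacking a h, dist p z' ≤ R → ∃ j : Fin N, dist (y j) (y i + A' (p - z')) ≤ ε) ∧
          (∀ j : Fin N, dist (y j) (y i) ≤ R →
            ∃ p ∈ hcpStacking a h, dist (y j) (y i + A' (p - z')) ≤ ε) := by
  intro N y i a h R ε s k₀ i₀ j₀ M A _ha hh hε hR hs halt hTW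
  obtain ⟨hfwd, hbwd⟩ := hTW
  obtain ⟨B, hBu, hBv, hBw, hBe⟩ := exists_linearIsometry_sign a h (hs k₀)
  have hz0 : barlowPos a h alternatingHagg 0 0 0 = (0 : E3) := by simp [barlowPos]
  refine ⟨barlowPos a h alternatingHagg 0 0 0, barlowPos_mem 0 0 0, A.comp B, ?_, ?_⟩
  · -- first clause: hcp points near the base are matched by particles
    intro q hq hqR
    obtain ⟨t, i', j', rfl⟩ := hq
    rw [hz0, dist_zero_right] at hqR
    have htM : |t| ≤ M :=
      abs_le_of_norm_lt hh (barlowPos_apply_two a h alternatingHagg t i' j') (by linarith)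
    have key := barlowPos_add_sub_eq_of_alternating (hs k₀) rfl halt hBu hBv hBw hBe i₀ j₀ htM i' j'
    have hdist : dist (barlowPos a h s (k₀ + t) (i₀ + s k₀ * i') (j₀ + s k₀ * j'))
        (barlowPos a h s k₀ i₀ j₀) ≤ R := by
      rwa [dist_eq_norm, key, LinearIsometry.norm_map]
    obtain ⟨j, hj⟩ := hfwd _ (barlowPos_mem _ _ _) hdist
    refine ⟨j, ?_⟩
    rwa [hz0, sub_zero, LinearIsometry.coe_comp, Function.comp_apply, ← key]
  · -- second clause: particles near `y i` are matched by hcp points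
    intro j hj
    obtain ⟨p, hp, hpj⟩ := hbwd j hj
    obtain ⟨k, i', j', rfl⟩ := hp
    have hnorm : ‖barlowPos a h s k i' j' - barlowPos a h s k₀ i₀ j₀‖ < M * h := by
      have ht := dist_triangle (y i + A (barlowPos a h s k i' j' - barlowPos a h s k₀ i₀ j₀)) (y j) (y i)
      rw [dist_comm _ (y j)] at ht
      have hd : dist (y i + A (barlowPos a h s k i' j' - barlowPos a h s k₀ i₀ j₀)) (y i) =
          ‖barlowPos a h s k i' j' - barlowPos a h s k₀ i₀ j₀‖ := by
        rw [dist_eq_norm, add_sub_cancel_left, LinearIsometry.norm_map]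
      linarith
    have hx : (barlowPos a h s k i' j' - barlowPos a h s k₀ i₀ j₀) 2 = (k - k₀ : ℤ) * h := by
      rw [PiLp.sub_apply, barlowPos_apply_two, barlowPos_apply_two, Int.cast_sub, sub_mul]
    have hk : |k - k₀| ≤ M := abs_le_of_norm_lt hh hx hnorm
    have key := barlowPos_sub_eq_of_alternating (hs k₀) rfl halt hBu hBv hBw hBe i₀ j₀ hk i' j'
    refine ⟨barlowPos a h alternatingHagg (k - k₀) (s k₀ * (i' - i₀)) (s k₀ * (j' - j₀)),
      barlowPos_mem _ _ _, ?_⟩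
    rwa [hz0, sub_zero, LinearIsometry.coe_comp, Function.comp_apply, ← key]

end Summit.AtomisticToContinuum.Crystallization.Theorems.SquareWellLayerCake.StackingFaultSparsity
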